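import Summits.AtomisticToContinuum.BoseEinsteinCondensation.Theses.BECRewardDescent
import Summits.AtomisticToContinuum.BoseEinsteinCondensation.Theorems.BECRewardDescentWalkGlueBootstrap
import Summits.AtomisticToContinuum.BoseEinsteinCondensation.Theorems.BECRewardDescentWalkGlueCurve

/-!
# Crux `RewardChordBound` (stmt-AtomisticToContinuum-12876), line `registered` — stub 7
# `stub_chordFromModulus`: the reward walk proper

Stub file of the line lead's skeleton (`Cruxes/RewardChordBound/Lines/birth.lean`, reshaped),
landed `--supports stmt-AtomisticToContinuum-12876`; it proves the registered signature of stub 7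
BY NAME in the skeleton's namespace: at fixed `(v, ρ, N)` with `E₀^per < ∞`, the three
finite-volume inputs on the reward curve `R(t) = inf_Ψ (⟨Ψ,HΨ⟩ + t·(N − ⟨Ψ,n̂₀Ψ⟩))` — (rung)
`R(s₀) ≤ E₀ + s₀(η/4)N` at `s₀ = θρa`, (no kink) `2R(s) ≤ R(s+h) + R(s−h) + εh` for small `h` at
every `s > 0`, (modulus) `2R(s) ≤ R(s+h) + R(s−h) + 2h²CN/(c√(ρa)√s − 2hN)` at every `s ∈ (0, ρa]`
whose near-minimisers are `(1−η)`-condensed — give the chord bound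
`R(s) + (s/s₀)E₀ ≤ E₀ + (s/s₀)R(s₀) + sτN` on `(0, s₀]` for `θ = θ(η, c, C, τ) ∈ (0, 1]`.

* `stub_chordFromModulusAffineWalk` — the walk for an abstract family `i ↦ Eᵢ + t·Dᵢ`
  in `ℝ≥0∞` (`Dᵢ ≤ N`, `⨅ Eᵢ < ∞`) with an abstract condensation predicate `P` implied by
  `Dᵢ < ηN`, built on the landed `WalkGlue` files (concavity of the real curve, Griffiths' lemma,
  `chord_le_chord_add_of_sqrt_budget`, `ennreal_chord_of_real_chord`);
* `stub_chordFromModulus` — the registered signature: the abstract walk at `Eᵢ = ⟨Ψ,HΨ⟩`,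
  `Dᵢ = N − n₀(Ψ)`, `P = ((1−η)N ≤ n₀(Ψ))`, `θ := k²`, `k = min 1 (c·min(τ, η/16)/(4C))`.

References: [Griffiths1966] (concavity / Hellmann–Feynman of a ground-state energy in a coupling),
[Kato1966, Ch. VII §3], [LiebSeiringerYngvason2005]; route text of BECRewardDescent.
-/

noncomputable section

open Set Filter Topology
open scoped ENNReal

namespace Summit.AtomisticToContinuum.BoseEinsteinCondensation.Cruxes.RewardChordBound.Birth

open Summit.AtomisticToContinuum.BoseEinsteinCondensation.Theorems.WalkGlue

namespace ChordFromModulus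

/-- A symmetric-difference inequality `2a ≤ b + c + x` with `b, c` finite and `x ≥ 0` real passes to
real parts. [folklore] -/
theorem toReal_two_mul_le {a b c : ℝ≥0∞} {x : ℝ} (hb : b ≠ ⊤) (hc : c ≠ ⊤) (hx : 0 ≤ x)
    (h : 2 * a ≤ b + c + ENNReal.ofReal x) : 2 * a.toReal ≤ b.toReal + c.toReal + x := by
  have hbc : b + c ≠ ⊤ := ENNReal.add_ne_top.2 ⟨hb, hc⟩
  have h' := ENNReal.toReal_mono (ENNReal.add_ne_top.2 ⟨hbc, ENNReal.ofReal_ne_top⟩) h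
  rw [ENNReal.toReal_add hbc ENNReal.ofReal_ne_top, ENNReal.toReal_add hb hc,
    ENNReal.toReal_ofReal hx, ENNReal.toReal_mul] at h'
  simpa using h'

/-- Every member `t ↦ Eᵢ + t·Dᵢ` of the family with `Eᵢ < ∞` is an affine majorant of the real
reward curve on `[0, ∞)`. [folklore] -/
theorem toReal_iInf_affine_le {ι : Type*} (E D : ι → ℝ≥0∞) {M : ℝ≥0∞} (hD : ∀ i, D i ≤ M)
    (hM : M ≠ ⊤) {i : ι} (hi : E i ≠ ⊤) {t : ℝ} (ht : 0 ≤ t) :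
    (⨅ j, (E j + ENNReal.ofReal t * D j)).toReal ≤ (E i).toReal + t * (D i).toReal := by
  have hDi : D i ≠ ⊤ := ne_top_of_le_ne_top hM (hD i)
  have hne : E i + ENNReal.ofReal t * D i ≠ ⊤ :=
    ENNReal.add_ne_top.2 ⟨hi, ENNReal.mul_ne_top ENNReal.ofReal_ne_top hDi⟩
  have h := ENNReal.toReal_mono hne (iInf_le (fun j => E j + ENNReal.ofReal t * D j) i)
  rwa [ENNReal.toReal_add hi (ENNReal.mul_ne_top ENNReal.ofReal_ne_top hDi), ENNReal.toReal_mul,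
    ENNReal.toReal_ofReal ht] at h

/-- Depletion below `ηN` means `(1 − η)`-condensation: `N − n₀ < ηN ⇒ (1−η)N ≤ n₀` in `ℝ≥0∞`
(truncated subtraction throughout). [folklore] -/
theorem condensed_of_depletion_lt {N : ℕ} {η : ℝ} (hη : 0 ≤ η) {n : ℝ≥0∞}
    (h : (N : ℝ≥0∞) - n < ENNReal.ofReal (η * N)) : ENNReal.ofReal ((1 - η) * N) ≤ n := by
  have h1 : (N : ℝ≥0∞) ≤ n + ENNReal.ofReal (η * N) := by
    rw [add_comm]
    exact tsub_le_iff_right.1 h.le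
  have h2 : ENNReal.ofReal ((1 - η) * N) = (N : ℝ≥0∞) - ENNReal.ofReal (η * N) := by
    rw [show (1 - η) * (N : ℝ) = N - η * N by ring, ENNReal.ofReal_sub _ (by positivity),
      ENNReal.ofReal_natCast]
  rw [h2]
  exact tsub_le_iff_right.2 h1

/-- The walk scale: for `η, c, C, τ > 0` there is `k ∈ (0, 1]` with `4Ck/c ≤ τ` and
`4Ck/c ≤ η/16` (`θ := k²`, so that the walk budget `(4C√θ/c)N` fits under `τN` and `ηN/16`).
[folklore] -/
theorem exists_walk_scale {η c C τ : ℝ} (hη : 0 < η) (hc : 0 < c) (hC : 0 < C) (hτ : 0 < τ) :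
    ∃ k : ℝ, 0 < k ∧ k ≤ 1 ∧ 4 * C * k / c ≤ τ ∧ 4 * C * k / c ≤ η / 16 := by
  set m : ℝ := min τ (η / 16) with hm
  have hm0 : 0 < m := lt_min hτ (by positivity)
  have hc0 : c ≠ 0 := hc.ne'
  have hC0 : C ≠ 0 := hC.ne'
  have hkey : 4 * C * min 1 (c * m / (4 * C)) / c ≤ m :=
    calc 4 * C * min 1 (c * m / (4 * C)) / c ≤ 4 * C * (c * m / (4 * C)) / c := by
          gcongr
          exact min_le_right _ _
      _ = m := by field_simp
  exact ⟨min 1 (c * m / (4 * C)), lt_min one_pos (by positivity), min_le_left _ _,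
    hkey.trans (min_le_left _ _), hkey.trans (min_le_right _ _)⟩

/-- A concave function on `[0, ∞)` with no kink at `u > 0` — for every `ε > 0` some `h ∈ (0, u)`
has `2R(u) ≤ R(u+h) + R(u−h) + εh` — is differentiable at `u`: the left derivative is at most
the right one (slopes), and at least the right one (concavity). [folklore] -/
theorem differentiableAt_of_noKink {R : ℝ → ℝ} (hR : ConcaveOn ℝ (Ici 0) R) {u : ℝ} (hu : 0 < u)
    (hk : ∀ ε : ℝ, 0 < ε → ∃ h : ℝ, 0 < h ∧ h < u ∧ 2 * R u ≤ R (u + h) + R (u - h) + ε * h) :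
    DifferentiableAt ℝ R u := by
  have hl := differentiableWithinAt_Iio_of_concaveOn hR hu
  have hr := differentiableWithinAt_Ioi_of_concaveOn hR hu
  have hint : u ∈ interior (Ici (0 : ℝ)) := by rwa [interior_Ici]
  have h1 : derivWithin R (Ioi u) u ≤ derivWithin R (Iio u) u := by
    have h := hR.neg.leftDeriv_le_rightDeriv_of_mem_interior hint
    rw [derivWithin.neg, derivWithin.neg] at h
    linarith
  have h2 : derivWithin R (Iio u) u ≤ derivWithin R (Ioi u) u := by
    refine le_of_forall_pos_le_add fun ε hε => ?_
    obtain ⟨h, hh, hhu, hk2⟩ := hk ε hε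
    have hls : derivWithin R (Iio u) u ≤ slope R (u - h) u :=
      hR.leftDeriv_le_slope (mem_Ici.2 (by linarith)) (mem_Ici.2 hu.le) (by linarith) hl
    have hrs : slope R u (u + h) ≤ derivWithin R (Ioi u) u :=
      hR.slope_le_rightDeriv (mem_Ici.2 hu.le) (mem_Ici.2 (by linarith)) (by linarith) hr
    rw [slope_def_field, sub_sub_cancel, le_div_iff₀ hh] at hls
    rw [slope_def_field, add_sub_cancel_left, div_le_iff₀ hh] at hrs
    refine le_of_mul_le_mul_right ?_ hh
    linarith
  have heq : derivWithin R (Iio u) u = derivWithin R (Ioi u) u := le_antisymm h2 h1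
  have hboth : HasDerivWithinAt R (derivWithin R (Ioi u) u) (Iic u ∪ Ici u) u :=
    (hl.hasDerivWithinAt.congr_deriv heq).Iic_of_Iio.union hr.hasDerivWithinAt.Ici_of_Ioi
  rw [Iic_union_Ici] at hboth
  exact (hboth.hasDerivAt univ_mem).differentiableAt

end ChordFromModulus

open ChordFromModulus in
/-- **The reward walk, abstract form (registered helper stub `stub_chordFromModulusAffineWalk`).**
For a family `i ↦ Eᵢ + t·Dᵢ` in `ℝ≥0∞` with `Dᵢ ≤ N`, `⨅ Eᵢ < ∞`, reward curve
`R(t) = ⨅ᵢ (Eᵢ + t·Dᵢ)` and a predicate `P` ("condensed") implied by `Dᵢ < ηN`: IF (rung)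
`R(s₀) ≤ ⨅E + s₀(η/4)N` at `s₀ = θρa`, (no kink) at every `s > 0`, and (modulus) at every
`s ∈ (0, ρa]`, `h ∈ (0, s)` with `2hN < c√(ρa)√s` whenever the near-minimisers of `Eᵢ + s·Dᵢ`
satisfy `P`, THEN `R(s) + (s/s₀)⨅E ≤ ⨅E + (s/s₀)R(s₀) + sτN` on `(0, s₀]`, provided
`4C√θ/c ≤ τ` and `4C√θ/c ≤ η/16`. Proof: `N = 0` — `R` is constant; `N ≥ 1` —
`WalkGlue.chord_le_chord_add_of_sqrt_budget` for the concave real curve, differentiable by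
`differentiableAt_of_noKink`, with the local response bound at `u` obtained from (modulus) after
Griffiths' lemma has made the near-minimisers at `u` condensed (`R'(u) < ηN`). [folklore] -/
theorem stub_chordFromModulusAffineWalk :
    ∀ (ι : Type) (E D : ι → ENNReal) (P : ι → Prop) (Rₑ : ℝ → ENNReal) (N : ℕ) (η c C τ θ ρ a : ℝ),
      (∀ t : ℝ, Rₑ t = ⨅ i, (E i + ENNReal.ofReal t * D i)) → 0 < η → 0 < c → 0 ≤ C → 0 < θ →
      θ ≤ 1 → 4 * C * Real.sqrt θ / c ≤ τ → 4 * C * Real.sqrt θ / c ≤ η / 16 →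
      (∀ i, D i ≤ (N : ENNReal)) → (⨅ i, E i) ≠ ⊤ → (∀ i, D i < ENNReal.ofReal (η * N) → P i) →
      (0 < θ * ρ * a → Rₑ (θ * ρ * a) ≤ (⨅ i, E i) + ENNReal.ofReal (θ * ρ * a * (η / 4) * N)) →
      (∀ s : ℝ, 0 < s → ∀ ε : ℝ, 0 < ε → ∃ h₀ : ℝ, 0 < h₀ ∧ ∀ h : ℝ, 0 < h → h < h₀ →
        2 * Rₑ s ≤ Rₑ (s + h) + Rₑ (s - h) + ENNReal.ofReal (ε * h)) →
      (∀ s h : ℝ, 0 < h → h < s → s ≤ ρ * a → 2 * h * N < c * Real.sqrt (ρ * a) * Real.sqrt s →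
        (∃ δ : ENNReal, 0 < δ ∧ ∀ i, E i + ENNReal.ofReal s * D i ≤ Rₑ s + δ → P i) →
        2 * Rₑ s ≤ Rₑ (s + h) + Rₑ (s - h) + ENNReal.ofReal
          (2 * h ^ 2 * (C * N) / (c * Real.sqrt (ρ * a) * Real.sqrt s - 2 * h * N))) →
      ∀ s : ℝ, 0 < s → s ≤ θ * ρ * a →
      Rₑ s + ENNReal.ofReal (s / (θ * ρ * a)) * (⨅ i, E i) ≤ (⨅ i, E i) +
        ENNReal.ofReal (s / (θ * ρ * a)) * Rₑ (θ * ρ * a) + ENNReal.ofReal (s * τ * N) := by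
  intro ι E D P Rₑ N η c C τ θ ρ a hRdef hη hc hC hθ hθ1 hθτ hθη hD hE hP hrung hkink hmod s hs hsle
  have hN : (N : ℝ≥0∞) ≠ ⊤ := ENNReal.natCast_ne_top N
  have hfin : ∀ t, Rₑ t ≠ ⊤ := fun t => (hRdef t).symm ▸ iInf_affine_ne_top E D hD hN hE t
  have hR0 : Rₑ 0 = ⨅ i, E i := (hRdef 0).trans (iInf_affine_zero E D)
  have hs₀ : 0 < θ * ρ * a := hs.trans_le hsle
  have hρa : 0 < ρ * a := by
    rw [mul_assoc] at hs₀
    exact pos_of_mul_pos_right hs₀ hθ.le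
  -- no particles: the curve is constant
  rcases Nat.eq_zero_or_pos N with hN0 | hNpos
  · subst hN0
    have hD0 : ∀ i, D i = 0 := fun i => le_antisymm ((hD i).trans (by simp)) bot_le
    have hconst : ∀ t, Rₑ t = ⨅ i, E i := fun t => by simp [hRdef, hD0]
    rw [hconst, hconst]
    exact le_self_add
  have hNr : (0 : ℝ) < N := Nat.cast_pos.2 hNpos
  -- the real curve
  obtain ⟨Rr, hRr⟩ : ∃ Rr : ℝ → ℝ, ∀ t, (Rₑ t).toReal = Rr t := ⟨_, fun _ => rfl⟩
  have hconc : ConcaveOn ℝ (Ici 0) Rr := by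
    have h := concaveOn_toReal_iInf_affine E D hD hN hE
    simp only [← hRdef, hRr] at h
    exact h
  have hcont : ContinuousWithinAt Rr (Ici 0) 0 := by
    have h := continuousWithinAt_toReal_iInf_affine E D hD hN hE
    simp only [← hRdef, hRr] at h
    exact h
  -- no kink: the real curve is differentiable on `(0, ∞)`
  have hdiff : ∀ u : ℝ, 0 < u → DifferentiableAt ℝ Rr u := by
    intro u hu
    refine differentiableAt_of_noKink hconc hu fun ε hε => ?_
    obtain ⟨h₀, hh₀, hk⟩ := hkink u hu ε hε
    have hlt₁ : min (h₀ / 2) (u / 2) < h₀ := (min_le_left _ _).trans_lt (half_lt_self hh₀)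
    have hlt₂ : min (h₀ / 2) (u / 2) < u := (min_le_right _ _).trans_lt (half_lt_self hu)
    have hpos : 0 < min (h₀ / 2) (u / 2) := lt_min (half_pos hh₀) (half_pos hu)
    refine ⟨min (h₀ / 2) (u / 2), hpos, hlt₂, ?_⟩
    have h := toReal_two_mul_le (hfin _) (hfin _) (by positivity) (hk _ hpos hlt₁)
    simpa only [hRr] using h
  -- reduction to the real chord inequality
  rw [← hR0]
  refine ennreal_chord_of_real_chord hs hs₀ (hfin 0) (hfin s) (hfin _) ?_
  simp only [hRr]
  have hc0 : c ≠ 0 := hc.ne'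
  have hsqρa : 0 < Real.sqrt (ρ * a) := Real.sqrt_pos.2 hρa
  have hsq0 : Real.sqrt (ρ * a) ≠ 0 := hsqρa.ne'
  set A : ℝ := C * N / (c * Real.sqrt (ρ * a)) with hA
  have hA0 : 0 ≤ A := by positivity
  have hbudget : 4 * A * Real.sqrt (θ * ρ * a) = 4 * C * Real.sqrt θ / c * N := by
    rw [mul_assoc θ, Real.sqrt_mul hθ.le, hA]
    field_simp
  refine chord_le_chord_add_of_sqrt_budget (β := η * N) (β₀ := η / 4 * N) (T := τ * N) hconc hcont
    hs₀ (fun u hu => hdiff u hu.1) hA0 ?_ ?_ ?_ ?_ s ⟨hs, hsle⟩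
  · -- the local response bound below the condensation threshold
    intro u hu hdu ε hε
    have hu0 : 0 < u := hu.1
    have hua : u ≤ ρ * a :=
      hu.2.le.trans (by rw [mul_assoc]; exact mul_le_of_le_one_left hρa.le hθ1)
    -- Griffiths: the near-minimisers at `u` are condensed
    have hcond : ∃ δ : ℝ≥0∞, 0 < δ ∧ ∀ i, E i + ENNReal.ofReal u * D i ≤ Rₑ u + δ → P i := by
      obtain ⟨δ', hδ', hG⟩ :=
        near_min_le_leftDeriv_add hconc hu0 (ε := (η * N - deriv Rr u) / 2) (by linarith)
      refine ⟨ENNReal.ofReal δ', ENNReal.ofReal_pos.2 hδ', fun i hi => hP i ?_⟩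
      have hDi : D i ≠ ⊤ := ne_top_of_le_ne_top hN (hD i)
      have hsum : E i + ENNReal.ofReal u * D i ≠ ⊤ :=
        ne_top_of_le_ne_top (ENNReal.add_ne_top.2 ⟨hfin u, ENNReal.ofReal_ne_top⟩) hi
      have hEi : E i ≠ ⊤ := (ENNReal.add_ne_top.1 hsum).1
      have hmin : ∀ t : ℝ, 0 ≤ t → Rr t ≤ (E i).toReal + t * (D i).toReal := fun t ht => by
        rw [← hRr, hRdef]
        exact toReal_iInf_affine_le E D hD hN hEi ht
      have hnear : (E i).toReal + u * (D i).toReal ≤ Rr u + δ' := by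
        have h := ENNReal.toReal_mono (ENNReal.add_ne_top.2 ⟨hfin u, ENNReal.ofReal_ne_top⟩) hi
        rwa [ENNReal.toReal_add hEi (ENNReal.mul_ne_top ENNReal.ofReal_ne_top hDi),
          ENNReal.toReal_mul, ENNReal.toReal_ofReal hu0.le,
          ENNReal.toReal_add (hfin u) ENNReal.ofReal_ne_top, ENNReal.toReal_ofReal hδ'.le,
          hRr] at h
      have hd := hG _ _ hmin hnear
      rw [(hdiff u hu0).derivWithin (uniqueDiffWithinAt_Iio u)] at hd
      exact (ENNReal.lt_ofReal_iff_toReal_lt hDi).2 (by linarith)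
    -- the modulus at `u` for all small `h > 0`
    obtain ⟨g, hg⟩ : ∃ g : ℝ, c * Real.sqrt (ρ * a) * Real.sqrt u = g := ⟨_, rfl⟩
    have hgpos : 0 < g := by
      rw [← hg]
      positivity
    have hAu : A / Real.sqrt u = C * N / g := by
      have hsu : Real.sqrt u ≠ 0 := (Real.sqrt_pos.2 hu0).ne'
      rw [hA, ← hg]
      field_simp
    have htend : Tendsto (fun h : ℝ => 2 * (C * N) / (g - 2 * h * N)) (𝓝 0)
        (𝓝 (2 * (C * N) / g)) := by
      have h1 : Tendsto (fun h : ℝ => g - 2 * h * N) (𝓝 0) (𝓝 (g - 2 * 0 * N)) :=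
        (by fun_prop : Continuous fun h : ℝ => g - 2 * h * N).tendsto 0
      rw [mul_zero, zero_mul, sub_zero] at h1
      exact tendsto_const_nhds.div h1 hgpos.ne'
    have hev₁ : ∀ᶠ h in 𝓝 (0 : ℝ), 2 * (C * N) / (g - 2 * h * N) < 2 * (C * N) / g + ε :=
      htend (Iio_mem_nhds (by linarith))
    have hev₂ : ∀ᶠ h in 𝓝 (0 : ℝ), 2 * h * N < g := by
      have h1 : Tendsto (fun h : ℝ => 2 * h * N) (𝓝 0) (𝓝 (2 * 0 * N)) :=
        (by fun_prop : Continuous fun h : ℝ => 2 * h * N).tendsto 0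
      rw [mul_zero, zero_mul] at h1
      exact h1 (Iio_mem_nhds hgpos)
    have hev₃ : ∀ᶠ h in 𝓝[>] (0 : ℝ), 0 < h ∧ h < u := by
      filter_upwards [Ioo_mem_nhdsGT hu0] with h hh using hh
    have hev : ∀ᶠ h in 𝓝[>] (0 : ℝ),
        -((2 * (A / Real.sqrt u) + ε) * h ^ 2) ≤ Rr (u + h) + Rr (u - h) - 2 * Rr u := by
      filter_upwards [hev₃, (hev₁.and hev₂).filter_mono nhdsWithin_le_nhds] with h hh₃ hh₁₂
      obtain ⟨hh0, hhu⟩ := hh₃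
      obtain ⟨hK, hhg⟩ := hh₁₂
      have hm := hmod u h hh0 hhu hua (by rw [hg]; exact hhg) hcond
      rw [hg] at hm
      have hX0 : 0 ≤ 2 * h ^ 2 * (C * N) / (g - 2 * h * N) :=
        div_nonneg (by positivity) (by linarith)
      have hr := toReal_two_mul_le (hfin _) (hfin _) hX0 hm
      simp only [hRr] at hr
      have hK' : 2 * (C * N) / (g - 2 * h * N) ≤ 2 * (C * N / g) + ε := by
        rw [← mul_div_assoc]
        exact hK.le
      have hXle : 2 * h ^ 2 * (C * N) / (g - 2 * h * N) ≤ (2 * (A / Real.sqrt u) + ε) * h ^ 2 := by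
        rw [hAu]
        calc 2 * h ^ 2 * (C * N) / (g - 2 * h * N)
            = 2 * (C * N) / (g - 2 * h * N) * h ^ 2 := by ring
          _ ≤ (2 * (C * N / g) + ε) * h ^ 2 := mul_le_mul_of_nonneg_right hK' (sq_nonneg h)
      linarith
    exact hev.frequently
  · -- the initial rung, in real form
    have h := slope_le_of_ennreal_rung (Rₑ := Rₑ) (τ := η / 4) (N := (N : ℝ)) hs₀ (by positivity)
      (hfin 0) (by rw [hR0]; exact hrung hs₀)
    simpa only [hRr] using h
  · -- the budget fits under the condensation threshold
    rw [hbudget]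
    have h := mul_le_mul_of_nonneg_right hθη hNr.le
    nlinarith [mul_pos hη hNr]
  · -- the budget is the walk cost
    rw [hbudget]
    exact mul_le_mul_of_nonneg_right hθτ hNr.le


open Literature.MathematicalPhysics.QuantumManyBody.BoseGas in
/-- **stub 7 — `ChordFromModulus` (the WALK proper: real analysis of the concave reward curve plus
the condensation bootstrap).** For all `η, c, C, τ > 0` there is `θ ∈ (0, 1]` (here `θ = k²`,
`k = min(1, c·min(τ, η/16)/(4C))`) such that at every `(ρ, N)` with `E₀^per < ∞`: IF (rung 1)
`R(s₀) ≤ E₀ + s₀(η/4)N` at `s₀ = θρa`, (no kink) `R` has no kinks on `(0, ∞)`, and (modulus) at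
every `s ∈ (0, ρa]` whose near-minimisers are `(1−η)`-condensed the second difference of `R` with
step `h < s`, `2hN < c√(ρa s)`, is `≤ 2h²CN/(c√(ρa s) − 2hN)`, THEN
`R(s) + (s/s₀)E₀ ≤ E₀ + (s/s₀)R(s₀) + sτN` on `(0, s₀]`. This is
`stub_chordFromModulusAffineWalk` at `Eᵢ = ⟨Ψ,HΨ⟩`, `Dᵢ = N − n₀(Ψ)` (so `Dᵢ ≤ N`
by truncated subtraction), `P = ((1−η)N ≤ n₀(Ψ))` (`ChordFromModulus.condensed_of_depletion_lt`).
[cite: Griffiths1966, §III] [cite: Kato1966, VII §3] [cite: LiebSeiringerYngvason2005, §2] -/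
theorem stub_chordFromModulus :
    ∀ (v : ℝ → ENNReal) (η c C τ : ℝ), 0 < η → 0 < c → 0 < C → 0 < τ → ∃ θ : ℝ, 0 < θ ∧ θ ≤ 1 ∧ ∀ (ρ
      : ℝ) (N : ℕ), Literature.MathematicalPhysics.QuantumManyBody.BoseGas.periodicGroundStateEnergy
      v N (Literature.MathematicalPhysics.QuantumManyBody.BoseGas.sideLength ρ N) ≠ ⊤ → (0 < θ * ρ *
      (Literature.MathematicalPhysics.QuantumManyBody.BoseGas.scatteringLength v).toReal → (⨅ Ψ :
      Literature.MathematicalPhysics.QuantumManyBody.BoseGas.PeriodicTrialState N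
      (Literature.MathematicalPhysics.QuantumManyBody.BoseGas.sideLength ρ N),
      (Literature.MathematicalPhysics.QuantumManyBody.BoseGas.periodicEnergy v Ψ + ENNReal.ofReal (θ
      * ρ * (Literature.MathematicalPhysics.QuantumManyBody.BoseGas.scatteringLength v).toReal) *
      ((N : ENNReal) - Literature.MathematicalPhysics.QuantumManyBody.BoseGas.condensateOccupation N
      (Literature.MathematicalPhysics.QuantumManyBody.BoseGas.sideLength ρ N) Ψ.ψ))) ≤
      Literature.MathematicalPhysics.QuantumManyBody.BoseGas.periodicGroundStateEnergy v N
      (Literature.MathematicalPhysics.QuantumManyBody.BoseGas.sideLength ρ N) + ENNReal.ofReal (θ *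
      ρ * (Literature.MathematicalPhysics.QuantumManyBody.BoseGas.scatteringLength v).toReal * (η /
      4) * N)) → (∀ s : ℝ, 0 < s → ∀ ε : ℝ, 0 < ε → ∃ h₀ : ℝ, 0 < h₀ ∧ ∀ h : ℝ, 0 < h → h < h₀ → 2 *
      (⨅ Ψ : Literature.MathematicalPhysics.QuantumManyBody.BoseGas.PeriodicTrialState N
      (Literature.MathematicalPhysics.QuantumManyBody.BoseGas.sideLength ρ N),
      (Literature.MathematicalPhysics.QuantumManyBody.BoseGas.periodicEnergy v Ψ + ENNReal.ofReal s
      * ((N : ENNReal) - Literature.MathematicalPhysics.QuantumManyBody.BoseGas.condensateOccupation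
      N (Literature.MathematicalPhysics.QuantumManyBody.BoseGas.sideLength ρ N) Ψ.ψ))) ≤ (⨅ Ψ :
      Literature.MathematicalPhysics.QuantumManyBody.BoseGas.PeriodicTrialState N
      (Literature.MathematicalPhysics.QuantumManyBody.BoseGas.sideLength ρ N),
      (Literature.MathematicalPhysics.QuantumManyBody.BoseGas.periodicEnergy v Ψ + ENNReal.ofReal (s
      + h) * ((N : ENNReal) -
      Literature.MathematicalPhysics.QuantumManyBody.BoseGas.condensateOccupation N
      (Literature.MathematicalPhysics.QuantumManyBody.BoseGas.sideLength ρ N) Ψ.ψ))) + (⨅ Ψ :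
      Literature.MathematicalPhysics.QuantumManyBody.BoseGas.PeriodicTrialState N
      (Literature.MathematicalPhysics.QuantumManyBody.BoseGas.sideLength ρ N),
      (Literature.MathematicalPhysics.QuantumManyBody.BoseGas.periodicEnergy v Ψ + ENNReal.ofReal (s
      - h) * ((N : ENNReal) -
      Literature.MathematicalPhysics.QuantumManyBody.BoseGas.condensateOccupation N
      (Literature.MathematicalPhysics.QuantumManyBody.BoseGas.sideLength ρ N) Ψ.ψ))) +
      ENNReal.ofReal (ε * h)) → (∀ s h : ℝ, 0 < h → h < s → s ≤ ρ *
      (Literature.MathematicalPhysics.QuantumManyBody.BoseGas.scatteringLength v).toReal → 2 * h * N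
      < c * Real.sqrt (ρ * (Literature.MathematicalPhysics.QuantumManyBody.BoseGas.scatteringLength
      v).toReal) * Real.sqrt s → (∃ δ : ENNReal, 0 < δ ∧ ∀ Ψ :
      Literature.MathematicalPhysics.QuantumManyBody.BoseGas.PeriodicTrialState N
      (Literature.MathematicalPhysics.QuantumManyBody.BoseGas.sideLength ρ N),
      (Literature.MathematicalPhysics.QuantumManyBody.BoseGas.periodicEnergy v Ψ + ENNReal.ofReal s
      * ((N : ENNReal) - Literature.MathematicalPhysics.QuantumManyBody.BoseGas.condensateOccupation
      N (Literature.MathematicalPhysics.QuantumManyBody.BoseGas.sideLength ρ N) Ψ.ψ)) ≤ (⨅ Ψ :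
      Literature.MathematicalPhysics.QuantumManyBody.BoseGas.PeriodicTrialState N
      (Literature.MathematicalPhysics.QuantumManyBody.BoseGas.sideLength ρ N),
      (Literature.MathematicalPhysics.QuantumManyBody.BoseGas.periodicEnergy v Ψ + ENNReal.ofReal s
      * ((N : ENNReal) - Literature.MathematicalPhysics.QuantumManyBody.BoseGas.condensateOccupation
      N (Literature.MathematicalPhysics.QuantumManyBody.BoseGas.sideLength ρ N) Ψ.ψ))) + δ →
      ENNReal.ofReal ((1 - η) * N) ≤
      Literature.MathematicalPhysics.QuantumManyBody.BoseGas.condensateOccupation N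
      (Literature.MathematicalPhysics.QuantumManyBody.BoseGas.sideLength ρ N) Ψ.ψ) → 2 * (⨅ Ψ :
      Literature.MathematicalPhysics.QuantumManyBody.BoseGas.PeriodicTrialState N
      (Literature.MathematicalPhysics.QuantumManyBody.BoseGas.sideLength ρ N),
      (Literature.MathematicalPhysics.QuantumManyBody.BoseGas.periodicEnergy v Ψ + ENNReal.ofReal s
      * ((N : ENNReal) - Literature.MathematicalPhysics.QuantumManyBody.BoseGas.condensateOccupation
      N (Literature.MathematicalPhysics.QuantumManyBody.BoseGas.sideLength ρ N) Ψ.ψ))) ≤ (⨅ Ψ :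
      Literature.MathematicalPhysics.QuantumManyBody.BoseGas.PeriodicTrialState N
      (Literature.MathematicalPhysics.QuantumManyBody.BoseGas.sideLength ρ N),
      (Literature.MathematicalPhysics.QuantumManyBody.BoseGas.periodicEnergy v Ψ + ENNReal.ofReal (s
      + h) * ((N : ENNReal) -
      Literature.MathematicalPhysics.QuantumManyBody.BoseGas.condensateOccupation N
      (Literature.MathematicalPhysics.QuantumManyBody.BoseGas.sideLength ρ N) Ψ.ψ))) + (⨅ Ψ :
      Literature.MathematicalPhysics.QuantumManyBody.BoseGas.PeriodicTrialState N
      (Literature.MathematicalPhysics.QuantumManyBody.BoseGas.sideLength ρ N),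
      (Literature.MathematicalPhysics.QuantumManyBody.BoseGas.periodicEnergy v Ψ + ENNReal.ofReal (s
      - h) * ((N : ENNReal) -
      Literature.MathematicalPhysics.QuantumManyBody.BoseGas.condensateOccupation N
      (Literature.MathematicalPhysics.QuantumManyBody.BoseGas.sideLength ρ N) Ψ.ψ))) +
      ENNReal.ofReal (2 * h ^ 2 * (C * N) / (c * Real.sqrt (ρ *
      (Literature.MathematicalPhysics.QuantumManyBody.BoseGas.scatteringLength v).toReal) *
      Real.sqrt s - 2 * h * N))) → ∀ s : ℝ, 0 < s → s ≤ θ * ρ *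
      (Literature.MathematicalPhysics.QuantumManyBody.BoseGas.scatteringLength v).toReal →
    let L : ℝ := Literature.MathematicalPhysics.QuantumManyBody.BoseGas.sideLength ρ N;
    let s₀ : ℝ := θ * ρ * (Literature.MathematicalPhysics.QuantumManyBody.BoseGas.scatteringLength
        v).toReal;
    let R : ℝ → ENNReal := fun t => ⨅ Ψ :
        Literature.MathematicalPhysics.QuantumManyBody.BoseGas.PeriodicTrialState N L,
        (Literature.MathematicalPhysics.QuantumManyBody.BoseGas.periodicEnergy v Ψ + ENNReal.ofReal
        t * ((N : ENNReal) -
        Literature.MathematicalPhysics.QuantumManyBody.BoseGas.condensateOccupation N L Ψ.ψ));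
    R s + ENNReal.ofReal (s / s₀) *
      Literature.MathematicalPhysics.QuantumManyBody.BoseGas.periodicGroundStateEnergy v N L ≤
      Literature.MathematicalPhysics.QuantumManyBody.BoseGas.periodicGroundStateEnergy v N L +
      ENNReal.ofReal (s / s₀) * R s₀ + ENNReal.ofReal (s * τ * N) := by
  intro v η c C τ hη hc hC hτ
  obtain ⟨k, hk0, hk1, hkτ, hkη⟩ := ChordFromModulus.exists_walk_scale hη hc hC hτ
  have hsq : Real.sqrt (k ^ 2) = k := Real.sqrt_sq hk0.le
  refine ⟨k ^ 2, by positivity, pow_le_one₀ hk0.le hk1, ?_⟩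
  intro ρ N hE₀ hrung hkink hmod s hs hsle
  exact stub_chordFromModulusAffineWalk _ (fun Ψ => periodicEnergy v Ψ)
    (fun Ψ => (N : ℝ≥0∞) - condensateOccupation N (sideLength ρ N) Ψ.ψ)
    (fun Ψ => ENNReal.ofReal ((1 - η) * N) ≤ condensateOccupation N (sideLength ρ N) Ψ.ψ)
    (fun t => ⨅ Ψ : PeriodicTrialState N (sideLength ρ N), (periodicEnergy v Ψ +
      ENNReal.ofReal t * ((N : ℝ≥0∞) - condensateOccupation N (sideLength ρ N) Ψ.ψ)))
    N η c C τ (k ^ 2) ρ _ (fun _ => rfl) hη hc hC.le (by positivity) (pow_le_one₀ hk0.le hk1)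
    (by rw [hsq]; exact hkτ) (by rw [hsq]; exact hkη) (fun _ => tsub_le_self) hE₀
    (fun Ψ h => ChordFromModulus.condensed_of_depletion_lt hη.le h) hrung hkink hmod s hs hsle

end Summit.AtomisticToContinuum.BoseEinsteinCondensation.Cruxes.RewardChordBound.Birth

end
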